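import Literature.MathematicalPhysics.QuantumFieldTheory.Balaban1983to89.B7Prop7OneStepAnalytic
import Literature.MathematicalPhysics.QuantumFieldTheory.Balaban1983to89.B13Contraction113
import Literature.MathematicalPhysics.QuantumFieldTheory.Balaban1983to89.B7Eq122LinearPartIsLinear
import Literature.MathematicalPhysics.QuantumFieldTheory.Balaban1983to89.B9Eq315QLipschitz

/-!
# `Balaban1983to89.B7Eq123BackgroundModulus` — T. Bałaban, *Averaging operations for lattice gauge theories*, Commun. Math. Phys. **98** (1985) 17–51
# [Balaban1985Averaging] Proposition 7 p. 43 («analyticity of Q_k(U₀, ηA) with respect to U₀») with (121)–(123) p. 36: THE ONE-STEP AVERAGE `Q(V, A, c)` IS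
# LIPSCHITZ IN THE BACKGROUND AT THE FLAT POINT — `‖Q(V, A, c) − Q(1, A, c)‖ ≤ K(d, L)·ε·a` for unit-bounded `V` with `‖V(b) − 1‖ ≤ ε` and `|A| ≤ a`
# small, by a CAUCHY ESTIMATE IN THE BACKGROUND VARIABLE along `τ ↦ e^{τ log V}` on the kernel theorem `B7Prop7OneStepAnalytic.prop7_oneStep_analyticAt`

statement-level skeleton of published theorems with citation tags; proofs where landed; nothing here is a claim about the Yang–Mills mass gap

PDF held: `paper:balaban1985-cmp98-averaging` (journal page = PDF page + 16); p. 43 through the verbatim quotation of `B7Prop7OneStep` / `B7Prop7OneStepAnalytic`: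
*«Another analyticity result we will need is an analyticity of Q_k(U₀, ηA) with respect to U₀. … We take U′U₀ instead of U₀, U′ = e^{iηA′}, |A′| < α₁, and we
consider the function Q_k(U′U₀, ηA). We want to prove that it is an analytic function of both variables A′ and A … Proposition 7. For U₀ satisfying (52) and
U′ = e^{iηA′}, |A′| < α₁, α₀, α₁ sufficiently small, the function Q_k(U′U₀, ηA) is analytic in complex variables A′, A, and Proposition 4 holds uniformly in A′.»*
Print states ANALYTICITY; a Lipschitz MODULUS in the background follows by a Cauchy estimate — the cell's reading, proved here for one step at `U₀ = 1`.

WHY THIS FILE (cell context).  The pub-balaban NE9 chain's chart of the curve species `cur U` is Lipschitz in the background at the flat point MODULO the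
background modulus `δ_C` of the Sect. C letter `C(U)` (`B11Eq44COperatorTorus.Cc`, built from `B7Prop3GeneralLinear.Ccov = Qcov − linQcov` at the periodic
extension) — `Support/NE9CurChartLipschitzAtFlat` (NE9 owner gen 82).  The linear part's modulus is ne9-leaf-04's `B9Eq315QLipschitz.norm_linQcov_sub_flat_le_of_bonds`;
this file supplies the modulus of the NONLINEAR one-step average `Qcov` itself, hence of `Ccov`, at the `ℤ^d` level, with a constant depending on `d` and `L` only.

WHAT IS PROVED (sorry-free; no `Prop` placeholder; no inequality of the paper asserted — print's Prop. 7 is an analyticity STATEMENT, used here through the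
tree's kernel theorem `prop7_oneStep_analyticAt_expCfg`).
* `expCfg_zero'` (`e^{0} = 1` as a configuration of units), `expCfg_mlog` (`e^{log V} = V` bondwise for `‖V(b) − 1‖ < 1`).
* **`norm_Qcov_sub_flat_le`** — for `‖V(b) − 1‖ ≤ ε ≤ 1∕(12288·N)` (no unit-boundedness needed), `N = (2d+2)L`, and `sup_b‖A(b)‖ ≤ a ≤ c₃(d,L)∕4`:
  `‖Q(V, A, c) − Q(1, A, c)‖ ≤ 75497472·(d+1)·L·N·ε·a` — the family `h(τ) = Q(e^{τX}, A, c)`, `X = log V` (`‖X(b)‖ ≤ 2ε`, `MatrixLog`), is analytic on the disc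
  `|τ| < R = 1∕(4096Nε)` (`prop7_oneStep_analyticAt_expCfg` at `V₀ = 1`, `a″ = 2Rε`) and bounded there by `6144(d+1)L·a` (`B7Prop7OneStep.norm_Qcov_cplx_le_crude_explicit`,
  uniform in the perturbation); the Cauchy∕mean-value estimate `B13Contraction113.norm_sub_le_of_sphere_bound` on circles of radius `R − 2 ≥ R∕3` around `[0, 1]` gives
  `‖h(1) − h(0)‖ ≤ 3·6144(d+1)La∕R`.
* **`norm_Ccov_sub_flat_le`** — the same for the remainder (122)–(123) `C = Q − (linear part)`: `‖C(V, A, c) − C(1, A, c)‖ ≤ (75497472(d+1)LN + 102(d+1)²L²)·ε·a`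
  (+ ne9-leaf-04's modulus of the linear part, `α`-regular block loops read off the bonds).
MODEL / HONEST SCOPE.  ONE step (`k = 1`) at the FLAT background `U₀ = 1` only; crude constants (the Cauchy route, not print's sharp (126)); NOT the `k`-level statement, NOT
uniformity «in A′» of Prop. 4; NOT summit progress (cell pub-balaban: NE9 NOT PRINTED / NOT PROVED; spine PROVED 0/9).  Filed by the pub-balaban NE9 BINDER-row owner
lineage `b2b-balaban-t4-ne9-p1` (gen 82); NEW file importing `B7Prop7OneStepAnalytic`, `B13Contraction113`, `B7Eq122LinearPartIsLinear`, `B9Eq315QLipschitz` only; nothing of the b07 / NE7c crews' files modified.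
Net new unproved facts: 0.
-/

noncomputable section

open scoped BigOperators
open NormedSpace Metric Set

namespace Literature.MathematicalPhysics.QuantumFieldTheory.Balaban1983to89.B7Eq123BackgroundModulus

open B7Prop1Explicit B7Prop3Flat B7Prop3GeneralLinear MatrixLog
open B7Prop7OneStep (norm_Qcov_cplx_le_crude_explicit norm_bond_expCfg_sub_one_le)
open B7Prop7OneStepAnalytic (prop7_oneStep_analyticAt_expCfg)
open B7Eq122LinearPartIsLinear (one_mem_U1 flat_regular)
open B13Contraction113 (norm_sub_le_of_sphere_bound)
open B9Eq315QLipschitz (norm_linQcov_sub_flat_le_of_bonds norm_Wcx_sub_one_le)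

-- `Site` alone would resolve to the torus sites of `Setup.lean`; re-export the `ℤ^d` sites of `B7Prop1Explicit`.
export B7Prop1Explicit (Site)

variable {d : ℕ} {𝔸 : Type*} [NormedRing 𝔸] [NormedAlgebra ℂ 𝔸] [CompleteSpace 𝔸] [NormOneClass 𝔸]

/-! ## §1 The exponential chart of the background: `e^{0} = 1`, `e^{log V} = V` -/

omit [NormOneClass 𝔸] in
/-- `e^{0} = 1` as a configuration of units. [cite: Balaban1985Averaging, (109) p.33] -/
theorem expCfg_zero' : expCfg (0 : Site d → Fin d → 𝔸) = 1 := by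
  funext x κ
  exact Units.ext (by rw [expCfg, val_expUnit, Pi.zero_apply, Pi.zero_apply, exp_zero]; rfl)

omit [NormOneClass 𝔸] in
/-- `e^{log V} = V` bondwise, for `‖V(b) − 1‖ < 1` (the series logarithm (21), `MatrixLog.exp_mlog`). [cite: Balaban1985Averaging, (21)–(27) pp.21–22] -/
theorem expCfg_mlog (V : Site d → Fin d → 𝔸ˣ) (hV : ∀ x κ, ‖((V x κ : 𝔸ˣ) : 𝔸) - 1‖ < 1) :
    expCfg (fun x κ => mlog ((V x κ : 𝔸ˣ) : 𝔸)) = V := by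
  funext x κ
  exact Units.ext (by rw [expCfg, val_expUnit, exp_mlog (hV x κ)])

/-! ## §2 The one-step average is Lipschitz in the background at the flat point -/

/-- **`‖Q(V, A, c) − Q(1, A, c)‖ ≤ 75497472·(d+1)·L·N·ε·a`** (`N = (2d+2)L`) for a unit-bounded background `ε`-close to `1` (`ε ≤ 1∕(12288N)`) and a field
`|A| ≤ a ≤ c₃(d,L)∕4` — Prop. 7's analyticity in the background read as a LIPSCHITZ MODULUS at `U₀ = 1` by a Cauchy estimate along `τ ↦ e^{τ log V}`
(analytic on `|τ| < 1∕(4096Nε)` with the sup bound `6144(d+1)La` of `B7Prop7OneStep`; circles of radius `R − 2` around `[0,1]`).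
[cite: Balaban1985Averaging, Proposition 7 p.43, (121)–(126) p.36] -/
theorem norm_Qcov_sub_flat_le {L : ℕ} (hL : 1 ≤ L) {V : Site d → Fin d → 𝔸ˣ} {ε : ℝ} (hε : 0 ≤ ε)
    (hεmax : ε ≤ 1 / (12288 * ((2 * (d * L) + L + L : ℕ) : ℝ))) (hVε : ∀ x κ, ‖((V x κ : 𝔸ˣ) : 𝔸) - 1‖ ≤ ε)
    (A : Site d → Fin d → 𝔸) {a : ℝ} (ha : 0 ≤ a) (hA : ∀ x κ, ‖A x κ‖ ≤ a) (hac : a ≤ c3 d L / 4) (q : Site d) (κ : Fin d) :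
    ‖Qcov L V A q κ - Qcov L (1 : Site d → Fin d → 𝔸ˣ) A q κ‖ ≤
      75497472 * ((d : ℝ) + 1) * L * ((2 * (d * L) + L + L : ℕ) : ℝ) * ε * a := by
  set N : ℝ := ((2 * (d * L) + L + L : ℕ) : ℝ) with hNdef
  have hN1 : (1 : ℝ) ≤ N := by
    have : 1 ≤ 2 * (d * L) + L + L := by omega
    rw [hNdef]; exact_mod_cast this
  have hN : 0 < N := by linarith
  rcases hε.eq_or_lt with h0 | hpos
  · -- `ε = 0`: the background IS flat
    have hV1 : V = 1 := by
      funext x κ'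
      have h := hVε x κ'
      rw [← h0] at h
      exact Units.ext (by simpa [sub_eq_zero] using norm_le_zero_iff.1 h)
    rw [hV1, sub_self, norm_zero, ← h0]; positivity
  -- the logarithms of the bond variables
  have hε2 : ε ≤ 1 / 2 := hεmax.trans (by
    rw [div_le_div_iff₀ (by positivity) (by norm_num)]; nlinarith)
  set X : Site d → Fin d → 𝔸 := fun x κ => mlog ((V x κ : 𝔸ˣ) : 𝔸) with hXdef
  have hX : ∀ x κ', ‖X x κ'‖ ≤ 2 * ε := fun x κ' =>
    (norm_mlog_le_two_mul ((hVε x κ').trans hε2)).trans (by linarith [hVε x κ'])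
  have hVexp : expCfg X = V := expCfg_mlog V fun x κ' => (hVε x κ').trans_lt (by linarith)
  -- the radius of analyticity in the background variable
  set R : ℝ := 1 / (4096 * N * ε) with hRdef
  have hR : 0 < R := by rw [hRdef]; positivity
  have hR3 : 3 ≤ R := by
    rw [hRdef, le_div_iff₀ (by positivity)]
    have := mul_le_mul_of_nonneg_left hεmax (by positivity : (0 : ℝ) ≤ 12288 * N)
    rw [mul_one_div_cancel (by positivity)] at this
    nlinarith
  have hRε : R * ε = 1 / (4096 * N) := by rw [hRdef]; field_simp
  -- the family `h(τ) = Q(e^{τX}·1, A, c)`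
  set h : ℂ → 𝔸 := fun τ => Qcov L (expCfg (τ • X) * (1 : Site d → Fin d → 𝔸ˣ)) A q κ with hhdef
  have h1 : h 1 = Qcov L V A q κ := by
    simp only [hhdef, one_smul, hVexp, mul_one]
  have h0' : h 0 = Qcov L (1 : Site d → Fin d → 𝔸ˣ) A q κ := by
    simp only [hhdef, zero_smul, expCfg_zero', mul_one]
  -- bond sizes of `τ • X` on the disc
  have hτX : ∀ τ : ℂ, ‖τ‖ < R → ∀ x κ', ‖(τ • X) x κ'‖ ≤ 2 * R * ε := fun τ hτ x κ' => by
    rw [Pi.smul_apply, Pi.smul_apply, norm_smul]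
    calc ‖τ‖ * ‖X x κ'‖ ≤ R * (2 * ε) := mul_le_mul hτ.le (hX x κ') (norm_nonneg _) hR.le
      _ = 2 * R * ε := by ring
  have h2Rε : 2 * R * ε = 1 / (2048 * N) := by rw [mul_assoc, hRε]; field_simp; norm_num
  have hNa : N * a ≤ 1 / 256 := by
    have hL0 : (0 : ℝ) < L := by exact_mod_cast hL
    have hc3 : c3 d L / 4 = 1 / (512 * ((d : ℝ) + 1) * L) := by rw [c3]; field_simp; ring
    have hNle : N ≤ 2 * ((d : ℝ) + 1) * L := by rw [hNdef]; push_cast; nlinarith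
    calc N * a ≤ 2 * ((d : ℝ) + 1) * L * (1 / (512 * ((d : ℝ) + 1) * L)) :=
          mul_le_mul hNle (hac.trans (le_of_eq hc3)) ha (by positivity)
      _ = 1 / 256 := by field_simp; ring
  -- analyticity on the disc
  have hd : DifferentiableOn ℂ h (ball (0 : ℂ) R) := fun τ hτ => by
    rw [mem_ball_zero_iff] at hτ
    have han := prop7_oneStep_analyticAt_expCfg (E := ℂ) hL (V₀ := (1 : Site d → Fin d → 𝔸ˣ)) (fun x κ' => one_mem_U1 x κ')
      (fun t : ℂ => t • X) (t₀ := τ) (fun x κ' => (analyticAt_id.smul analyticAt_const : AnalyticAt ℂ (fun t : ℂ => t • X x κ') τ))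
      (fun _ : ℂ => A) (fun x κ' => analyticAt_const) ha hA (a'' := 2 * R * ε) (by positivity) (hτX τ hτ)
      (θ := 1 / 128) (by
        rw [h2Rε]
        show N * (a + 4 * (1 / (2048 * N))) ≤ 1 / 128
        have e : N * (4 * (1 / (2048 * N))) = 1 / 512 := by field_simp; ring
        nlinarith [hNa, e]) (by norm_num) le_rfl q κ (α := 0) (by norm_num) (fun r => flat_regular q κ r)
    exact han.differentiableAt.differentiableWithinAt
  -- the sup bound on the disc, uniform in the perturbation
  have hM : ∀ τ : ℂ, ‖τ‖ < R → ‖h τ‖ ≤ 6144 * ((d : ℝ) + 1) * L * a := fun τ hτ => by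
    have hu1 : 2 * R * ε ≤ 1 / 64 := by rw [h2Rε, div_le_div_iff₀ (by positivity) (by norm_num)]; nlinarith
    have hexp : Real.exp (2 * R * ε) - 1 ≤ 2 * (2 * R * ε) := exp_sub_one_le_of_le le_rfl (by positivity) hu1
    have hU : ∀ x κ', ‖((expCfg (τ • X) x κ' : 𝔸ˣ) : 𝔸) - 1‖ ≤ 2 * (2 * R * ε) ∧
        ‖(((expCfg (τ • X) x κ')⁻¹ : 𝔸ˣ) : 𝔸) - 1‖ ≤ 2 * (2 * R * ε) := fun x κ' =>
      ⟨(norm_bond_expCfg_sub_one_le _ (hτX τ hτ) x κ').1.trans hexp, (norm_bond_expCfg_sub_one_le _ (hτX τ hτ) x κ').2.trans hexp⟩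
    have hun : N * (2 * (2 * R * ε)) ≤ 1 / 512 := by rw [h2Rε]; field_simp; nlinarith
    exact (norm_Qcov_cplx_le_crude_explicit hL (V₀ := (1 : Site d → Fin d → 𝔸ˣ)) (fun x κ' => one_mem_U1 x κ') (by positivity) hU
      (by rw [hNdef] at hun; exact hun) A ha hA hac q κ (α := 0) (by norm_num) (fun r => flat_regular q κ r)).2
  -- Cauchy on circles of radius `R − 2` around `[0, 1]`
  have hr : 0 < R - 2 := by linarith
  have hsub : ∀ t : ℝ, t ∈ Icc (0 : ℝ) 1 → closedBall (t : ℂ) (R - 2) ⊆ ball (0 : ℂ) R := fun t ht z hz => by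
    rw [mem_closedBall, dist_eq_norm] at hz
    rw [mem_ball_zero_iff]
    have ht1 : ‖(t : ℂ)‖ ≤ 1 := by rw [Complex.norm_real, Real.norm_of_nonneg ht.1]; exact ht.2
    calc ‖z‖ = ‖(z - t) + t‖ := by rw [sub_add_cancel]
      _ ≤ ‖z - (t : ℂ)‖ + ‖(t : ℂ)‖ := norm_add_le _ _
      _ < R := by linarith
  have hMs : ∀ t : ℝ, t ∈ Icc (0 : ℝ) 1 → ∀ z ∈ sphere (t : ℂ) (R - 2), ‖h z‖ ≤ 6144 * ((d : ℝ) + 1) * L * a := fun t ht z hz =>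
    hM z (mem_ball_zero_iff.1 (hsub t ht (sphere_subset_closedBall hz)))
  have hC := norm_sub_le_of_sphere_bound isOpen_ball hd hr hsub hMs
  rw [h1, h0'] at hC
  refine hC.trans ?_
  -- `M∕(R − 2) ≤ 3M∕R = 3M·4096Nε`
  have hR2 : R / 3 ≤ R - 2 := by linarith
  have hMnn : 0 ≤ 6144 * ((d : ℝ) + 1) * L * a := by positivity
  calc 6144 * ((d : ℝ) + 1) * L * a / (R - 2) ≤ 6144 * ((d : ℝ) + 1) * L * a / (R / 3) :=
        div_le_div_of_nonneg_left hMnn (by positivity) hR2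
    _ = 75497472 * ((d : ℝ) + 1) * L * N * ε * a := by rw [hRdef]; field_simp; ring

/-! ## §3 The remainder (122)–(123) `C = Q − (linear part)` is Lipschitz in the background at the flat point -/

/-- **`‖C(V, A, c) − C(1, A, c)‖ ≤ (75497472(d+1)L·N + 102(d+1)²L²)·ε·a`** for a UNIT-BOUNDED background `ε`-close to `1` and `|A| ≤ a ≤ c₃(d,L)∕4` — §2 for
`Q` plus ne9-leaf-04's modulus of the linear part (`B9Eq315QLipschitz.norm_linQcov_sub_flat_le_of_bonds`, the `α`-regularity of the block loops read off the bonds by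
`norm_Wcx_sub_one_le`).  The background modulus `δ_C` of the NE9 chain's Sect. C letter at the `ℤ^d` level. [cite: Balaban1985Averaging, (122)–(123) p.36, Proposition 7 p.43] -/
theorem norm_Ccov_sub_flat_le {L : ℕ} (hL : 1 ≤ L) {V : Site d → Fin d → 𝔸ˣ} (hV : ∀ x κ, V x κ ∈ U1 𝔸) {ε : ℝ} (hε : 0 ≤ ε)
    (hεmax : ε ≤ 1 / (12288 * ((2 * (d * L) + L + L : ℕ) : ℝ))) (hVε : ∀ x κ, ‖((V x κ : 𝔸ˣ) : 𝔸) - 1‖ ≤ ε)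
    (A : Site d → Fin d → 𝔸) {a : ℝ} (ha : 0 ≤ a) (hA : ∀ x κ, ‖A x κ‖ ≤ a) (hac : a ≤ c3 d L / 4) (q : Site d) (κ : Fin d) :
    ‖Ccov L V A q κ - Ccov L (1 : Site d → Fin d → 𝔸ˣ) A q κ‖ ≤
      (75497472 * ((d : ℝ) + 1) * L * ((2 * (d * L) + L + L : ℕ) : ℝ) + 102 * ((d : ℝ) + 1) ^ 2 * L * L) * ε * a := by
  have hL0 : (0 : ℝ) < L := by exact_mod_cast hL
  have hN1 : 2 * ((d : ℝ) + 1) * L ≤ ((2 * (d * L) + L + L : ℕ) : ℝ) := by push_cast; nlinarith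
  -- the block loops are `2(d+1)Lε`-regular, `2(d+1)Lε ≤ 1/64`
  have hα : 2 * ((d : ℝ) + 1) * L * ε ≤ 1 / 64 := by
    have h1 : 12288 * ((2 * (d * L) + L + L : ℕ) : ℝ) * ε ≤ 1 := by
      have := mul_le_mul_of_nonneg_left hεmax (by positivity : (0 : ℝ) ≤ 12288 * ((2 * (d * L) + L + L : ℕ) : ℝ))
      rwa [mul_one_div_cancel (by positivity)] at this
    nlinarith [mul_nonneg (by positivity : (0 : ℝ) ≤ 2 * ((d : ℝ) + 1) * L) hε]
  have hWα : ∀ r : Fin d → Fin L, ‖((Wcx L V q κ (boxVec L r) : 𝔸ˣ) : 𝔸) - 1‖ ≤ 2 * (d + 1) * L * ε := fun r =>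
    norm_Wcx_sub_one_le hV hVε L q κ r hε
  have hlin := norm_linQcov_sub_flat_le_of_bonds L hV hVε ha hA hL q κ hα hWα hε
  have hQ := norm_Qcov_sub_flat_le hL hε hεmax hVε A ha hA hac q κ
  have e : Ccov L V A q κ - Ccov L (1 : Site d → Fin d → 𝔸ˣ) A q κ =
      (Qcov L V A q κ - Qcov L (1 : Site d → Fin d → 𝔸ˣ) A q κ) -
        (linQcov L V A q κ - linQcov L (1 : Site d → Fin d → 𝔸ˣ) A q κ) := by
    rw [Ccov, Ccov]; abel
  rw [e]
  refine (norm_sub_le _ _).trans ?_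
  refine (add_le_add hQ hlin).trans (le_of_eq ?_)
  ring

end Literature.MathematicalPhysics.QuantumFieldTheory.Balaban1983to89.B7Eq123BackgroundModulus

end
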